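import Mathlib
import Summits.CriticalPhenomena.PercolationContinuityZ3.Theorems.PercNearOneGluingNoHeavyLowerTailFatMinorityPivotalCells
import Summits.CriticalPhenomena.PercolationContinuityZ3.Theorems.PercNearOneGluingNoHeavyLowerTailFatMinorityOnePortCertificate
import HarnessLib

/-!
# `NoHeavyLowerTail` (stmt-CriticalPhenomena-4575), line fat-minority-linear — the SLACK EDGE LEMMA (T4 / (B1)),
# core step, from QUT4 one port down (route task `nh-dp-fatminority`, gen 11; PROOF-UT4-upto3ports.md (B1))

`μ = prodBernoulli w` on the pairs of `Fin n`; `o ∉ A` an observer whose positive-weight pairs go to `A` (no loop at `o`);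
`a ∈ A` a port, `e = s(o,a)`, `p = w(e)`; `w₀ = w[e↦0]`, `w₁ = w[e↦1]`, `μ₀, μ₁` their laws; `piv t = μ₁(t↔b) − μ₀(t↔b)`
the pivotality of `e` for `t ↔ b`; `m ≤ min_{v∈A} μ(v↔b)`, `σ = μ(a↔b) − m` the slack of the port `a`.

`slackEdge_core` (one round of the bootstrap of (B1)): if `p < 1`, `0 ≤ Pmax`, every other port `v` has
`(1−p)(piv v − piv a) − σ ≤ Pmax`, and QUT4 holds for the star of `o` with ports `A ∖ {a}` in the law `μ₀` for every
threshold dominating the gaps `μ₀(a↔b) − μ₀(v↔b)` (hypothesis `hIH` — THEOREM A/B of the notes one port down), then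
for every vertex `c ≠ o`: `(1−p)(piv c − piv a) ≤ σ + p·Pmax`.
Proof: `piv c − piv a = Σ_T μ₀(σ_T)·[cell bracket]` over the star patterns `T ⊆ A ∖ {a}` (one-bond decomposition,
`glueSet_pushforward`, forced cell laws `UpsetExchange.real_inter_starEvent_eq_mul_forced`); each cell is at most
`κ_T · H_T` (`cell_pivot_le` = `pivotalComparison`, BHK Thm 1.4/1.5), `κ_T = ν_T(o↔c | a↮o)` is monotone in `T`
(`rl3_winner`, `glueStar_real_notConn`), and the layer cake `upsetLayerCake_sum_le` bounds `Σ κ_T H_T` by `t'·Σ μ₀(σ_T) ≤ t'`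
with `t' = (σ + pPmax)/(1−p)` admissible by the bookkeeping `μ₀ = μ − p·piv`.  No definitions.
-/

namespace Summit.CriticalPhenomena.PercolationContinuityZ3.Theorems

open MeasureTheory Set
open Literature.Probability.LatticeModels (prodBernoulli)
open Literature.Probability.Percolation

noncomputable section
open scoped Classical

variable {n : ℕ}

/-- `{o ↔ c} ∩ σ_∅ = ∅` for `c ≠ o`: under the empty star pattern the observer is isolated. [folklore] -/
theorem openConn_inter_starEvent_empty (o c : Fin n) (hco : c ≠ o) :
    (openConn o c : Set (BondConfig (Fin n))) ∩ starEvent o ((↑(∅ : Finset (Fin n))) : Set (Fin n)) = ∅ := by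
  ext ω
  simp only [mem_inter_iff, mem_empty_iff_false, iff_false, not_and, Finset.coe_empty]
  intro hoc hσ
  exact KNPreFKG.not_reachable_of_mem_starEvent_empty hσ hco hoc

/-- **Core of the slack edge lemma** (one round of the bootstrap, see the module docstring):
`(1−p)(piv c − piv a) ≤ σ + p·Pmax`.
[cite: KozmaNitzan2024, Lemma 4 p. 9 (qualitative pivotality comparison); VandenbergHaggstromKahn2005, Thm. 1.4/1.5 (p. 7); reduction: route notes gen 8 §4b (B1)] -/
theorem slackEdge_core (w : Sym2 (Fin n) → unitInterval) (A : Finset (Fin n)) (o a b c : Fin n)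
    (hoA : o ∉ A) (haA : a ∈ A) (hco : c ≠ o)
    (hiso : ∀ u, u ≠ o → u ∉ A → w s(o, u) = 0) (hloop : w s(o, o) = 0)
    (m Pmax : ℝ) (hm : ∀ v ∈ A, m ≤ (prodBernoulli w).real (openConn v b)) (hPmax0 : 0 ≤ Pmax)
    (hp1 : (w s(o, a) : ℝ) < 1)
    (hPmax : ∀ v ∈ A, v ≠ a →
      (1 - (w s(o, a) : ℝ)) *
          (((prodBernoulli (Function.update w s(o, a) 1)).real (openConn v b) -
              (prodBernoulli (Function.update w s(o, a) 0)).real (openConn v b)) -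
            ((prodBernoulli (Function.update w s(o, a) 1)).real (openConn a b) -
              (prodBernoulli (Function.update w s(o, a) 0)).real (openConn a b))) -
        ((prodBernoulli w).real (openConn a b) - m) ≤ Pmax)
    (hIH : ∀ t' : ℝ, 0 ≤ t' →
      (∀ v ∈ A.erase a, (prodBernoulli (Function.update w s(o, a) 0)).real (openConn a b) -
          (prodBernoulli (Function.update w s(o, a) 0)).real (openConn v b) ≤ t') →
      ∀ 𝒰 : Finset (Finset (Fin n)), 𝒰 ⊆ (A.erase a).powerset → ∅ ∉ 𝒰 →
        (∀ B ∈ 𝒰, ∀ B' ∈ (A.erase a).powerset, B ⊆ B' → B' ∈ 𝒰) →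
        (prodBernoulli (Function.update w s(o, a) 0)).real
              (openConn a b ∩ {ω | ∃ B ∈ 𝒰, ∀ u ∈ B, s(o, u) ∈ ω}) -
            (prodBernoulli (Function.update w s(o, a) 0)).real
              (openConn o b ∩ {ω | ∃ B ∈ 𝒰, ∀ u ∈ B, s(o, u) ∈ ω}) ≤
          t' * (prodBernoulli (Function.update w s(o, a) 0)).real {ω | ∃ B ∈ 𝒰, ∀ u ∈ B, s(o, u) ∈ ω}) :
    (1 - (w s(o, a) : ℝ)) *
        (((prodBernoulli (Function.update w s(o, a) 1)).real (openConn c b) -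
            (prodBernoulli (Function.update w s(o, a) 0)).real (openConn c b)) -
          ((prodBernoulli (Function.update w s(o, a) 1)).real (openConn a b) -
            (prodBernoulli (Function.update w s(o, a) 0)).real (openConn a b))) ≤
      ((prodBernoulli w).real (openConn a b) - m) + (w s(o, a) : ℝ) * Pmax := by
  set w₀ : Sym2 (Fin n) → unitInterval := Function.update w s(o, a) 0 with hw₀
  set w₁ : Sym2 (Fin n) → unitInterval := Function.update w s(o, a) 1 with hw₁
  set A' : Finset (Fin n) := A.erase a with hA'
  have hao : a ≠ o := fun h => hoA (h ▸ haA)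
  have hoa : o ≠ a := fun h => hao h.symm
  have hp0 : 0 ≤ (w s(o, a) : ℝ) := (w s(o, a)).2.1
  have h1p : 0 < 1 - (w s(o, a) : ℝ) := by linarith
  have hσ0 : 0 ≤ (prodBernoulli w).real (openConn a b) - m := by linarith [hm a haA]
  -- one-bond decomposition `μ = (1−p) μ₀ + p μ₁`
  have hbond : ∀ t : Fin n, (prodBernoulli w).real (openConn t b) =
      (1 - (w s(o, a) : ℝ)) * (prodBernoulli w₀).real (openConn t b) +
        (w s(o, a) : ℝ) * (prodBernoulli w₁).real (openConn t b) :=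
    fun t => prodBernoulli_real_oneBond (determinedBy_univ_fin _) w (Finset.mem_univ s(o, a))
  -- the admissible threshold one port down
  set t' : ℝ := ((prodBernoulli w).real (openConn a b) - m + (w s(o, a) : ℝ) * Pmax) / (1 - (w s(o, a) : ℝ))
    with ht'
  have ht'0 : 0 ≤ t' := div_nonneg (add_nonneg hσ0 (mul_nonneg hp0 hPmax0)) h1p.le
  have ht'eq : (1 - (w s(o, a) : ℝ)) * t' = (prodBernoulli w).real (openConn a b) - m + (w s(o, a) : ℝ) * Pmax := by
    simp only [ht']; field_simp
  have hdom : ∀ v ∈ A', (prodBernoulli w₀).real (openConn a b) - (prodBernoulli w₀).real (openConn v b) ≤ t' := by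
    intro v hv
    obtain ⟨hva, hvA⟩ := Finset.mem_erase.1 hv
    have h1 := hbond a
    have h2 := hbond v
    have h3 := hPmax v hvA hva
    have h4 := hm v hvA
    rw [le_div_iff₀ h1p]
    nlinarith [h1, h2, h3, h4, hp0, h1p]
  -- the smaller star: ports `A'`, law `μ₀`
  have hoA' : o ∉ A' := fun h => hoA (Finset.mem_of_mem_erase h)
  have hiso' : ∀ u, u ≠ o → u ∉ A' → w₀ s(o, u) = 0 := by
    intro u huo huA'
    by_cases hua : u = a
    · subst hua; simp only [hw₀, Function.update_self]
    · have hne : s(o, u) ≠ s(o, a) := fun h => hua (Sym2.congr_right.mp h)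
      simp only [hw₀, Function.update_of_ne hne]
      exact hiso u huo (fun huA => huA' (Finset.mem_erase.2 ⟨hua, huA⟩))
  have hloop' : w₀ s(o, o) = 0 := by
    have hne : s(o, o) ≠ s(o, a) := fun h => hao (Sym2.congr_right.mp h).symm
    simp only [hw₀, Function.update_of_ne hne]
    exact hloop
  -- forced cell laws
  set Wf : Finset (Fin n) → (Sym2 (Fin n) → unitInterval) := fun T f =>
    if o ∈ f then (if ∃ q ∈ T, f = s(o, q) then 1 else 0) else w₀ f with hWf
  have hforce : ∀ T ∈ A'.powerset, ∀ X : Set (BondConfig (Fin n)),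
      (prodBernoulli w₀).real (X ∩ starEvent o (↑T : Set (Fin n))) =
        (prodBernoulli w₀).real (starEvent o (↑T : Set (Fin n))) * (prodBernoulli (Wf T)).real X := by
    intro T hT X
    have hoT : o ∉ T := fun h => hoA' (Finset.mem_powerset.1 hT h)
    simpa only [hWf] using UpsetExchange.real_inter_starEvent_eq_mul_forced w₀ o T hoT hloop' X
  -- gluing `e`: `μ₁(Y) = μ₀{ω | ω ∪ {e} ∈ Y}`
  set G : Fin n → Set (BondConfig (Fin n)) := fun t =>
    {ω : BondConfig (Fin n) | ((ω ∪ {s(o, a)} : Set (Sym2 (Fin n))) : BondConfig (Fin n)) ∈ openConn t b} with hG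
  have hglue : ∀ t : Fin n, (prodBernoulli w₁).real (openConn t b) = (prodBernoulli w₀).real (G t) := by
    intro t
    refine glueSet_pushforward w₀ w₁ {s(o, a)} (fun f hf => ?_) (fun f hf => ?_) (openConn t b)
    · rw [mem_singleton_iff.1 hf, hw₁, Function.update_self]
    · have hne : f ≠ s(o, a) := fun h => hf (mem_singleton_iff.2 h)
      simp only [hw₀, hw₁, Function.update_of_ne hne]
  -- pivotalities as cell sums
  have hpiv : ∀ t : Fin n, (prodBernoulli w₁).real (openConn t b) - (prodBernoulli w₀).real (openConn t b) =
      ∑ T ∈ A'.powerset, (prodBernoulli w₀).real (starEvent o (↑T : Set (Fin n))) *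
        ((prodBernoulli (Wf T)).real (G t) - (prodBernoulli (Wf T)).real (openConn t b)) := by
    intro t
    rw [hglue, KNPreFKG.real_eq_sum_inter_starEvent w₀ A' o hoA' hiso' (G t),
      KNPreFKG.real_eq_sum_inter_starEvent w₀ A' o hoA' hiso' (openConn t b), ← Finset.sum_sub_distrib]
    refine Finset.sum_congr rfl fun T hT => ?_
    rw [hforce T hT, hforce T hT]
    ring
  -- `κ`, `H`, `π` on the cells
  set κ : Finset (Fin n) → ℝ := fun T =>
    if (prodBernoulli (Wf T)).real (openConn a o)ᶜ = 0 then 1 else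
      (prodBernoulli (Wf T)).real ((openConn a o)ᶜ ∩ openConn o c) / (prodBernoulli (Wf T)).real (openConn a o)ᶜ
    with hκ
  set H : Finset (Fin n) → ℝ := fun T =>
    (prodBernoulli w₀).real (openConn a b ∩ starEvent o (↑T : Set (Fin n))) -
      (prodBernoulli w₀).real (openConn o b ∩ starEvent o (↑T : Set (Fin n))) with hH
  set π : Finset (Fin n) → ℝ := fun T => (prodBernoulli w₀).real (starEvent o (↑T : Set (Fin n))) with hπ
  -- (1) the cells `T ≠ ∅`
  have hcell : ∀ T ∈ A'.powerset,
      π T * (((prodBernoulli (Wf T)).real (G c) - (prodBernoulli (Wf T)).real (openConn c b)) -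
        ((prodBernoulli (Wf T)).real (G a) - (prodBernoulli (Wf T)).real (openConn a b))) ≤ κ T * H T := by
    intro T hT
    have h : ((prodBernoulli (Wf T)).real (G c) - (prodBernoulli (Wf T)).real (openConn c b)) -
        ((prodBernoulli (Wf T)).real (G a) - (prodBernoulli (Wf T)).real (openConn a b)) ≤
        κ T * ((prodBernoulli (Wf T)).real (openConn a b) - (prodBernoulli (Wf T)).real (openConn o b)) := by
      simpa only [hκ, hG] using cell_pivot_le (Wf T) o a c b hoa
    have hσT : 0 ≤ π T := measureReal_nonneg
    have hHT : H T = π T *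
        ((prodBernoulli (Wf T)).real (openConn a b) - (prodBernoulli (Wf T)).real (openConn o b)) := by
      simp only [hH, hπ]
      rw [hforce T hT, hforce T hT]
      ring
    rw [hHT]
    nlinarith [mul_le_mul_of_nonneg_left h hσT]
  -- (1') the cell `T = ∅`: the observer is isolated there
  have h0mem : (∅ : Finset (Fin n)) ∈ A'.powerset := Finset.mem_powerset.2 (Finset.empty_subset _)
  have hcell0 : π ∅ * (((prodBernoulli (Wf ∅)).real (G c) - (prodBernoulli (Wf ∅)).real (openConn c b)) -
      ((prodBernoulli (Wf ∅)).real (G a) - (prodBernoulli (Wf ∅)).real (openConn a b))) ≤ 0 := by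
    have hdiff : ((prodBernoulli (Wf ∅)).real (G a) - (prodBernoulli (Wf ∅)).real (openConn a b)) -
        ((prodBernoulli (Wf ∅)).real (G c) - (prodBernoulli (Wf ∅)).real (openConn c b)) =
        (prodBernoulli (Wf ∅)).real ((openConn a o)ᶜ ∩ (openConn o b ∩ (openConn a c)ᶜ)) -
          (prodBernoulli (Wf ∅)).real ((openConn a o)ᶜ ∩ (openConn a b ∩ openConn o c)) := by
      simpa only [hG] using pivot_diff_eq (prodBernoulli (Wf ∅)) o a c b hoa
    have hz : π ∅ * (prodBernoulli (Wf ∅)).real (openConn o c) = 0 := by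
      have hf := hforce ∅ h0mem (openConn o c)
      rw [openConn_inter_starEvent_empty o c hco, measureReal_empty] at hf
      simp only [hπ]
      linarith
    have hle : (prodBernoulli (Wf ∅)).real ((openConn a o)ᶜ ∩ (openConn a b ∩ openConn o c)) ≤
        (prodBernoulli (Wf ∅)).real (openConn o c) := measureReal_mono (fun ω hω => hω.2.2)
    have hnn : 0 ≤ (prodBernoulli (Wf ∅)).real ((openConn a o)ᶜ ∩ (openConn o b ∩ (openConn a c)ᶜ)) :=
      measureReal_nonneg
    have hσ0' : 0 ≤ π ∅ := measureReal_nonneg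
    nlinarith [hdiff, hz, hle, hnn, hσ0', mul_le_mul_of_nonneg_left hle hσ0']
  -- (2) `κ ∈ [0,1]`, monotone on `𝒜' = 𝒫(A') ∖ {∅}`
  set 𝒜' : Finset (Finset (Fin n)) := A'.powerset.erase ∅ with h𝒜'
  have h𝒜'A : 𝒜' ⊆ A'.powerset := Finset.erase_subset _ _
  have hκ0 : ∀ T ∈ 𝒜', 0 ≤ κ T := by
    intro T _; simp only [hκ]; split_ifs
    · exact zero_le_one
    · exact div_nonneg measureReal_nonneg measureReal_nonneg
  have hκ1 : ∀ T ∈ 𝒜', κ T ≤ 1 := by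
    intro T _; simp only [hκ]; split_ifs
    · exact le_refl _
    · exact div_le_one_of_le₀ (measureReal_mono inter_subset_left) measureReal_nonneg
  have hκmono : ∀ T ∈ 𝒜', ∀ T' ∈ 𝒜', T ⊆ T' → κ T ≤ κ T' := by
    intro T hT T' hT' hTT'
    set Td : Finset (Fin n) := T' \ T with hTd
    have h1 : ∀ f ∈ ({f | ∃ u ∈ Td, f = s(o, u)} : Set (Sym2 (Fin n))), Wf T' f = 1 := by
      rintro f ⟨u, hu, rfl⟩
      have huT' : u ∈ T' := (Finset.mem_sdiff.1 hu).1
      have hof : o ∈ s(o, u) := Sym2.mem_mk_left o u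
      simp only [hWf, if_pos hof]
      rw [if_pos ⟨u, huT', rfl⟩]
    have h2 : ∀ f ∉ ({f | ∃ u ∈ Td, f = s(o, u)} : Set (Sym2 (Fin n))), Wf T' f = Wf T f := by
      intro f hf
      by_cases hof : o ∈ f
      · have hiff : (∃ q ∈ T', f = s(o, q)) ↔ (∃ q ∈ T, f = s(o, q)) := by
          constructor
          · rintro ⟨q, hq, rfl⟩
            by_cases hqT : q ∈ T
            · exact ⟨q, hqT, rfl⟩
            · exact (hf ⟨q, Finset.mem_sdiff.2 ⟨hq, hqT⟩, rfl⟩).elim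
          · rintro ⟨q, hq, rfl⟩
            exact ⟨q, hTT' hq, rfl⟩
        simp only [hWf, if_pos hof, hiff]
      · simp only [hWf, if_neg hof]
    -- pull-backs along the gluing
    have hD : (prodBernoulli (Wf T')).real (openConn a o)ᶜ =
        (prodBernoulli (Wf T)).real ((openConn a o)ᶜ ∩ {ω | ∀ u ∈ Td, ¬ (openGraph ω).Reachable a u}) :=
      (glueStar_real_notConn (Wf T) (Wf T') o a Td h1 h2 univ (fun _ _ _ _ => mem_univ _)).1
    have hDc : (prodBernoulli (Wf T)).real
          ((openConn a o)ᶜ ∩ {ω | ∀ u ∈ Td, ¬ (openGraph ω).Reachable a u} ∩ openConn o c) ≤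
        (prodBernoulli (Wf T')).real ((openConn a o)ᶜ ∩ openConn o c) := by
      rw [glueSet_pushforward (Wf T) (Wf T') _ h1 h2]
      refine measureReal_mono ?_
      rintro ω ⟨⟨hD', hN⟩, hoc⟩
      simp only [mem_setOf_eq, mem_inter_iff, mem_compl_iff, openConn] at hD' hoc ⊢
      exact ⟨(notReach_union_starPairs_iff o a Td ω).2 ⟨hD', hN⟩,
        hoc.mono (openGraph_mono subset_union_left)⟩
    -- BHK Thm 1.5 in `ν_T`: `{o↔c}` (increasing in `C_o`) and `{a ↮ T' ∖ T}` (decreasing in `C_a`) given `{o↮a}`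
    have hQN : ∀ ω ω' : BondConfig (Fin n), ω ∈ {ω | ∀ u ∈ Td, ¬ (openGraph ω).Reachable a u} →
        openEdgeCluster ω' a ⊆ openEdgeCluster ω a →
        ω' ∈ {ω | ∀ u ∈ Td, ¬ (openGraph ω).Reachable a u} :=
      fun ω ω' hω hsub u hu => pivotalComparison_notConn_downClosed a u ω ω' (hω u hu) hsub
    have hbhk := rl3_winner (Wf T) o a c univ {ω | ∀ u ∈ Td, ¬ (openGraph ω).Reachable a u}
      (fun _ _ _ _ => mem_univ _) hQN hoa
    rw [KNPreFKG.openConn_symm o a] at hbhk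
    simp only [univ_inter] at hbhk
    have hset : ((openConn a o)ᶜ ∩ (openConn o c ∩ {ω | ∀ u ∈ Td, ¬ (openGraph ω).Reachable a u}) :
        Set (BondConfig (Fin n))) =
        (openConn a o)ᶜ ∩ {ω | ∀ u ∈ Td, ¬ (openGraph ω).Reachable a u} ∩ openConn o c := by
      ext ω; simp only [mem_inter_iff]; tauto
    rw [hset] at hbhk
    show (if (prodBernoulli (Wf T)).real (openConn a o)ᶜ = 0 then (1 : ℝ) else
        (prodBernoulli (Wf T)).real ((openConn a o)ᶜ ∩ openConn o c) /
          (prodBernoulli (Wf T)).real (openConn a o)ᶜ) ≤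
      (if (prodBernoulli (Wf T')).real (openConn a o)ᶜ = 0 then (1 : ℝ) else
        (prodBernoulli (Wf T')).real ((openConn a o)ᶜ ∩ openConn o c) /
          (prodBernoulli (Wf T')).real (openConn a o)ᶜ)
    by_cases h2z : (prodBernoulli (Wf T')).real (openConn a o)ᶜ = 0
    · rw [if_pos h2z]
      split_ifs
      · exact le_refl _
      · exact div_le_one_of_le₀ (measureReal_mono inter_subset_left) measureReal_nonneg
    · rw [if_neg h2z]
      have h2pos : 0 < (prodBernoulli (Wf T')).real (openConn a o)ᶜ :=
        lt_of_le_of_ne measureReal_nonneg (Ne.symm h2z)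
      have hNpos : 0 < (prodBernoulli (Wf T)).real
          ((openConn a o)ᶜ ∩ {ω | ∀ u ∈ Td, ¬ (openGraph ω).Reachable a u}) := by rw [← hD]; exact h2pos
      have h1pos : 0 < (prodBernoulli (Wf T)).real (openConn a o)ᶜ :=
        lt_of_lt_of_le hNpos (measureReal_mono inter_subset_left)
      rw [if_neg h1pos.ne']
      calc (prodBernoulli (Wf T)).real ((openConn a o)ᶜ ∩ openConn o c) /
            (prodBernoulli (Wf T)).real (openConn a o)ᶜ
          ≤ (prodBernoulli (Wf T)).real
              ((openConn a o)ᶜ ∩ {ω | ∀ u ∈ Td, ¬ (openGraph ω).Reachable a u} ∩ openConn o c) /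
            (prodBernoulli (Wf T)).real ((openConn a o)ᶜ ∩ {ω | ∀ u ∈ Td, ¬ (openGraph ω).Reachable a u}) := by
            rw [div_le_div_iff₀ h1pos hNpos]
            nlinarith [hbhk]
        _ ≤ (prodBernoulli (Wf T')).real ((openConn a o)ᶜ ∩ openConn o c) /
            (prodBernoulli (Wf T')).real (openConn a o)ᶜ := by
            rw [hD]
            exact div_le_div_of_nonneg_right hDc hNpos.le
  -- (3) up-set sums of `H` one port down: the induction hypothesis
  have hπ0 : ∀ T ∈ 𝒜', 0 ≤ π T := fun T _ => measureReal_nonneg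
  have h𝒜'up : ∀ B ∈ 𝒜', ∀ B' ∈ A'.powerset, B ⊆ B' → B' ∈ 𝒜' := by
    intro B hB B' hB' hBB'
    refine Finset.mem_erase.2 ⟨?_, hB'⟩
    rintro rfl
    exact (Finset.mem_erase.1 hB).1 (Finset.subset_empty.1 hBB')
  have hHsum : ∀ 𝒰 ⊆ 𝒜', (∀ B ∈ 𝒰, ∀ B' ∈ 𝒜', B ⊆ B' → B' ∈ 𝒰) →
      ∑ T ∈ 𝒰, H T ≤ t' * ∑ T ∈ 𝒰, π T := by
    intro 𝒰 h𝒰 hup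
    have h𝒰A : 𝒰 ⊆ A'.powerset := h𝒰.trans h𝒜'A
    have h0 : ∅ ∉ 𝒰 := fun h => (Finset.mem_erase.1 (h𝒰 h)).1 rfl
    have hup' : ∀ B ∈ 𝒰, ∀ B' ∈ A'.powerset, B ⊆ B' → B' ∈ 𝒰 :=
      fun B hB B' hB' hBB' => hup B hB B' (h𝒜'up B (h𝒰 hB) B' hB' hBB') hBB'
    have h := hIH t' ht'0 hdom 𝒰 h𝒰A h0 hup'
    have hU : (prodBernoulli w₀).real {ω : BondConfig (Fin n) | ∃ B ∈ 𝒰, ∀ u ∈ B, s(o, u) ∈ ω} =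
        ∑ T ∈ 𝒰, π T := by
      have h' := real_inter_starUpEvent_eq_sum w₀ A' o hoA' hiso' 𝒰 h𝒰A hup' univ
      rw [univ_inter] at h'
      rw [h']
      exact Finset.sum_congr rfl fun T _ => by rw [univ_inter]
    rw [real_inter_starUpEvent_eq_sum w₀ A' o hoA' hiso' 𝒰 h𝒰A hup' (openConn a b),
      real_inter_starUpEvent_eq_sum w₀ A' o hoA' hiso' 𝒰 h𝒰A hup' (openConn o b), hU] at h
    simp only [hH]
    rw [Finset.sum_sub_distrib]
    exact h
  have hcake := upsetLayerCake_sum_le 𝒜' H κ π t' ht'0 hπ0 hκ0 hκ1 hκmono hHsum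
  -- total mass of the cells is at most one
  have hπle : ∑ T ∈ 𝒜', π T ≤ 1 := by
    have htot : ∑ T ∈ A'.powerset, π T = 1 := by
      have h' := KNPreFKG.real_eq_sum_inter_starEvent w₀ A' o hoA' hiso' univ
      have h1 : (prodBernoulli w₀).real univ = 1 := probReal_univ
      rw [h1] at h'
      rw [h']
      exact (Finset.sum_congr rfl fun T _ => by rw [univ_inter]).symm
    rw [← htot]
    exact Finset.sum_le_sum_of_subset_of_nonneg h𝒜'A fun T _ _ => measureReal_nonneg
  -- (4) assemble
  have hsplit := Finset.add_sum_erase A'.powerset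
    (fun T => π T * (((prodBernoulli (Wf T)).real (G c) - (prodBernoulli (Wf T)).real (openConn c b)) -
        ((prodBernoulli (Wf T)).real (G a) - (prodBernoulli (Wf T)).real (openConn a b)))) h0mem
  have hrest : ∑ T ∈ 𝒜', π T * (((prodBernoulli (Wf T)).real (G c) - (prodBernoulli (Wf T)).real (openConn c b)) -
        ((prodBernoulli (Wf T)).real (G a) - (prodBernoulli (Wf T)).real (openConn a b))) ≤
      ∑ T ∈ 𝒜', κ T * H T :=
    Finset.sum_le_sum fun T hT => hcell T (h𝒜'A hT)
  have hdiffsum : ((prodBernoulli w₁).real (openConn c b) - (prodBernoulli w₀).real (openConn c b)) -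
      ((prodBernoulli w₁).real (openConn a b) - (prodBernoulli w₀).real (openConn a b)) ≤ t' := by
    rw [hpiv c, hpiv a, ← Finset.sum_sub_distrib]
    have hrw : ∀ T ∈ A'.powerset,
        (prodBernoulli w₀).real (starEvent o (↑T : Set (Fin n))) *
            ((prodBernoulli (Wf T)).real (G c) - (prodBernoulli (Wf T)).real (openConn c b)) -
          (prodBernoulli w₀).real (starEvent o (↑T : Set (Fin n))) *
            ((prodBernoulli (Wf T)).real (G a) - (prodBernoulli (Wf T)).real (openConn a b)) =
        π T * (((prodBernoulli (Wf T)).real (G c) - (prodBernoulli (Wf T)).real (openConn c b)) -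
          ((prodBernoulli (Wf T)).real (G a) - (prodBernoulli (Wf T)).real (openConn a b))) :=
      fun T _ => by simp only [hπ]; ring
    rw [Finset.sum_congr rfl hrw, ← hsplit]
    nlinarith [hcell0, hrest, hcake, hπle, ht'0, mul_le_mul_of_nonneg_left hπle ht'0]
  calc (1 - (w s(o, a) : ℝ)) * (((prodBernoulli w₁).real (openConn c b) - (prodBernoulli w₀).real (openConn c b)) -
        ((prodBernoulli w₁).real (openConn a b) - (prodBernoulli w₀).real (openConn a b)))
      ≤ (1 - (w s(o, a) : ℝ)) * t' := mul_le_mul_of_nonneg_left hdiffsum h1p.le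
    _ = (prodBernoulli w).real (openConn a b) - m + (w s(o, a) : ℝ) * Pmax := ht'eq

end

end Summit.CriticalPhenomena.PercolationContinuityZ3.Theorems
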